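import Literature.Computability.Complexity.PolynomialEntropyApproximation

/-!
# PneNP / SzkEntropy — crux `PeaWorstToAvg` (stmt-PneNP-10777): entropy and promise membership
# are invariant along semantic equivalence of cubic maps (card `orbit-pair-rsr`, support)

Support lemmas for the crux chain's Card A (`Cruxes/PeaWorstToAvg/Ideas/orbit-pair-rsr.md`): the
hard ensemble there is "a fair coin `b`, then a uniformly re-randomised copy `q` of the explicit
cubic map `p_b` inside its orbit under `Aff_s(F₂) × Aff_m(F₂)`", and the crux's strict support
clause asks every such `q` to be a YES or a NO instance of `PEA 3`.  This holds because the output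
entropy `H(q(U_s))` is EXACTLY invariant along the orbit.  We prove the invariance in the semantic
form a line needs (no commitment to a syntactic presentation of the group action): if
`q(x) = g(p(e x))` for a bijection `e` of the input space `F₂ˢ` and a map `g` of output words that
is injective on the outputs of `p`, then `H(q) = H(p)` (`PolyMapF2.entropy_eq_of_semiconj`, from the
tree's `mapEntropy_univ_comp_equiv` and `mapEntropy_comp_of_injOn`), hence the encoded instance
`⟨s, (q, k)⟩` is a NO (resp. YES) instance of `PEA d` as soon as `p` has entropy `≤ k`
(resp. `≥ k + 1`) and `q` has syntactic degree `≤ d` (`encode_mem_PEA_no_of_semiconj`,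
`encode_mem_PEA_yes_of_semiconj`).  The probabilistic half of the re-randomisation (a uniform group
element carries any point of an orbit to the uniform law on the orbit) is the Literature file
`Probability/Distributions/UniformOrbit.lean`.

References: Z. Dvir, D. Gutfreund, G. Rothblum, S. Vadhan, *On approximating the entropy of
polynomial mappings*, ICS 2011, §3 p. 6 and pp. 2–3; T. Cover, J. Thomas, *Elements of Information
Theory*, 2nd ed., Problem 2.4 (entropy of an injective image).
-/

namespace Summit.PneNP.PneNP.Theorems

open Literature.Computability.Complexity

/-- **Output entropy is invariant along semantic equivalence.** If `q(x) = g(p(e x))` for all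
`x ∈ F₂ˢ`, with `e` a bijection of `F₂ˢ` and `g` injective on the outputs of `p`, then
`H(q(U_s)) = H(p(U_s))` — re-indexing the uniform input by `e` and relabelling outputs injectively
both preserve the output distribution up to relabelling. [DvirGutfreundRothblumVadhan2010, §3 p.6
(invariance of PEA under changes of variables); CoverThomas, Problem 2.4] -/
theorem PolyMapF2.entropy_eq_of_semiconj {s : ℕ} (p q : PolyMapF2 s)
    (e : (Fin s → ZMod 2) ≃ (Fin s → ZMod 2)) (g : List (ZMod 2) → List (ZMod 2))
    (hg : ∀ a b : Fin s → ZMod 2, g (p.eval a) = g (p.eval b) → p.eval a = p.eval b)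
    (hq : ∀ x, q.eval x = g (p.eval (e x))) : q.entropy = p.entropy := by
  have hfun : q.eval = (g ∘ p.eval) ∘ e := funext fun x => by simp [hq x]
  unfold PolyMapF2.entropy
  rw [hfun, mapEntropy_univ_comp_equiv e (g ∘ p.eval),
    mapEntropy_comp_of_injOn p.eval g fun a _ b _ h => hg a b h]

/-- **NO instances transfer along semantic equivalence**: if `H(p) ≤ k`, `q` is semantically
equivalent to `p` (as in `PolyMapF2.entropy_eq_of_semiconj`) and `q` has syntactic degree `≤ d`,
then `⟨s, (q, k)⟩` encodes a NO instance of `PEA d`. [DvirGutfreundRothblumVadhan2010, §3 p.6] -/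
theorem encode_mem_PEA_no_of_semiconj (d : ℕ) {s : ℕ} (p q : PolyMapF2 s) (k : ℕ)
    (hdeg : q.DegLE d)
    (e : (Fin s → ZMod 2) ≃ (Fin s → ZMod 2)) (g : List (ZMod 2) → List (ZMod 2))
    (hg : ∀ a b : Fin s → ZMod 2, g (p.eval a) = g (p.eval b) → p.eval a = p.eval b)
    (hq : ∀ x, q.eval x = g (p.eval (e x))) (hH : p.entropy ≤ k) :
    PEAInst.encoding.encode ⟨s, (q, k)⟩ ∈ (PEA d).no := by
  rw [encode_mem_PEA_no_iff]
  exact ⟨hdeg, by rw [PolyMapF2.entropy_eq_of_semiconj p q e g hg hq]; exact hH⟩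

/-- **YES instances transfer along semantic equivalence**: if `H(p) ≥ k + 1`, `q` is semantically
equivalent to `p` and has syntactic degree `≤ d`, then `⟨s, (q, k)⟩` encodes a YES instance of
`PEA d`. [DvirGutfreundRothblumVadhan2010, §3 p.6] -/
theorem encode_mem_PEA_yes_of_semiconj (d : ℕ) {s : ℕ} (p q : PolyMapF2 s) (k : ℕ)
    (hdeg : q.DegLE d)
    (e : (Fin s → ZMod 2) ≃ (Fin s → ZMod 2)) (g : List (ZMod 2) → List (ZMod 2))
    (hg : ∀ a b : Fin s → ZMod 2, g (p.eval a) = g (p.eval b) → p.eval a = p.eval b)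
    (hq : ∀ x, q.eval x = g (p.eval (e x))) (hH : (k : ℝ) + 1 ≤ p.entropy) :
    PEAInst.encoding.encode ⟨s, (q, k)⟩ ∈ (PEA d).yes := by
  rw [encode_mem_PEA_yes_iff]
  exact ⟨hdeg, by rw [PolyMapF2.entropy_eq_of_semiconj p q e g hg hq]; exact hH⟩

/-- **Affine changes of the input are bijections** (the `Aff_s(F₂)` half of the orbit action): for an
invertible matrix `A` and a shift `b`, `x ↦ A x + b` is (the underlying map of) an equivalence of
`F₂ˢ`, usable as the `e` of `PolyMapF2.entropy_eq_of_semiconj`. [DvirGutfreundRothblumVadhan2010,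
pp. 2–3 (random changes of variables)] -/
theorem exists_equiv_affineInput {s : ℕ} (A : Matrix (Fin s) (Fin s) (ZMod 2)) (hA : IsUnit A)
    (b : Fin s → ZMod 2) :
    ∃ e : (Fin s → ZMod 2) ≃ (Fin s → ZMod 2), ∀ x, e x = A.mulVec x + b :=
  ⟨(Matrix.toLinearEquiv' A hA.invertible).toEquiv.trans (Equiv.addRight b), fun x => by
    change (Matrix.toLinearEquiv' A hA.invertible : Module.End (ZMod 2) (Fin s → ZMod 2)) x + b = _
    rw [Matrix.toLinearEquiv'_apply, Matrix.toLin'_apply]⟩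

/-- **Affine changes of the output are injective** (the `Aff_m(F₂)` half): for an invertible `B`
and a shift `c`, `v ↦ B v + c` is injective on `F₂^m` (Mathlib `Matrix.mulVec_injective_iff_isUnit`),
usable — after the line's identification of output words with vectors — as the `g` of
`PolyMapF2.entropy_eq_of_semiconj`. [DvirGutfreundRothblumVadhan2010, pp. 2–3] -/
theorem affineOutput_injective {m : ℕ} (B : Matrix (Fin m) (Fin m) (ZMod 2)) (hB : IsUnit B)
    (c : Fin m → ZMod 2) : Function.Injective fun v : Fin m → ZMod 2 => B.mulVec v + c := by
  intro v w h
  have h' : B.mulVec v + c = B.mulVec w + c := h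
  exact Matrix.mulVec_injective_of_isUnit hB (add_right_cancel h')

end Summit.PneNP.PneNP.Theorems
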